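import Summits.Ventures.PercRepro.RankLevelSetBiIndepAbsorbStar

/-! # RankLevelSetAbsorbShadowTheta — THE KATONA SHADOW FORM OF (ABS-star) IS FALSE: ON `M(Θ(2,2,2,1)) ⊕ U_{1,2}`
(9 ELEMENTS) WITH `y` THE PARALLEL ELEMENT, THE MIDDLE STEP `A^y_4 ≤ A^y_5` HOLDS WITH EQUALITY (`20 = 20`) BUT THE
TWELVE MEMBERS THROUGH THE HUB EDGE HAVE ONLY EIGHT UP-NEIGHBOURS (night-1 g34; dossier §46.2; COMPUTATIONAL: the
matroid axioms and the counts are checked by `native_decide`)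

In the Boolean case the star-normalized step `(n − k) v_k ≤ k v_{k+1}` (g33, Katona's cycle method) holds in the
stronger SHADOW FORM `(n − k) #F ≤ k #∂⁺F` for every sub-family `F ⊆ V_k` (Katona 1964; the cell's
`card_upShadow_ge_of_intersecting`). The analogous statement for the absorbing profile — **`AbsorbShadowHall M y k`**:
`(#E − 1 − k) · #F ≤ k · #{W ∈ A^y_{k+1} : ∃ Z ∈ F, Z ⊆ W}` for every `F ⊆ A^y_k` — is the Hall condition for a
fractional `(#E − 1 − k) : k` matching in the containment graph `A^y_k → A^y_{k+1}`; it holds on every matroid with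
≤ 8 elements and fails on 9 elements exactly at the middle step `2k + 1 = #E` (night-1 g34 census, kit j323583: 180 of
1,713,027 instances). THE WITNESS: `theta9` = the cycle matroid of the theta graph `Θ(2,2,2,1)` (hubs joined by the
paths `{0,1}, {2,3}, {4,5}` and the edge `6`) plus a parallel pair `{7, 8}` as a separate component; an edge set is
independent iff it contains no whole path together with `6`, at most one whole path, and not both `7` and `8`
(`thetaIndep`). For `y = 7`: `A^7_4 = A^7_5 = 20` (`lowAbsorbCount_four`, `lowAbsorbCount_five` — the step holds with
equality: `A^7_{j+1} = D_j` of the contraction-deletion `M(Θ(2,2,2,1))`, g32), but the family `F₀` of the twelve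
members of `A^7_4` containing the hub edge `6` (`F0`) has only eight up-neighbours in `A^7_5` (`shadow_card`):
`4 · 12 = 48 > 32 = 4 · 8`, so **`not_absorbShadowHall_theta9 : ¬ AbsorbShadowHall theta9 7 4`**. CONSEQUENCE: no
proof of the middle step of (ABS-star) can charge members to their supersets — not a fractional matching in the
containment graph, not an averaging of per-structure inequalities that charge members upward (Katona's cycle method
with any family of local structures); the middle step needs the complement-swap `Z ↦ (E ∖ Z) − y + z` (here `z = 8`,
the parallel partner), which is also what g33's `absorbStar_of_parallel` uses. Every declaration has a docstring;
imports: the cell's own modules and Mathlib only. Axioms: standard plus `Lean.ofReduceBool` (`native_decide`) on the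
computational declarations. -/

namespace PercRepro

open Set Matroid

/-- **The Katona SHADOW FORM of (ABS-star) at level `k`** (night-1 g34; a `Prop`, FALSE in general — see
`not_absorbShadowHall_theta9`): for every sub-family `F` of the absorbing family `A^y_k`,
`(#E − 1 − k) · #F ≤ k · #{W ∈ A^y_{k+1} : ∃ Z ∈ F, Z ⊆ W}`. -/
def AbsorbShadowHall {α : Type} (M : Matroid α) (y : α) (k : ℕ) : Prop :=
  ∀ F ⊆ lowAbsorbAt M y k,
    (M.E.ncard - 1 - k) * F.ncard ≤ k * {W ∈ lowAbsorbAt M y (k + 1) | ∃ Z ∈ F, Z ⊆ W}.ncard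

namespace Theta9

/-- The three paths of `Θ(2,2,2,1)` as pairs of edges. -/
def paths : List (Finset (Fin 9)) := [{0, 1}, {2, 3}, {4, 5}]

/-- The number of whole paths contained in an edge set. -/
def fullCount (S : Finset (Fin 9)) : ℕ := (paths.filter (fun C => C ⊆ S)).length

/-- **The independent sets of `M(Θ(2,2,2,1)) ⊕ U_{1,2}`**: no whole path together with the hub edge `6`, at most one
whole path, and not both parallel edges `7`, `8`. -/
abbrev thetaIndep (S : Finset (Fin 9)) : Prop :=
  (fullCount S = 0 ∨ (fullCount S = 1 ∧ (6 : Fin 9) ∉ S)) ∧ ¬ (({7, 8} : Finset (Fin 9)) ⊆ S)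

/-- The empty set is independent. -/
theorem thetaIndep_empty : thetaIndep ∅ := by decide

/-- Subsets of independent sets are independent (checked over all pairs of edge sets). -/
theorem thetaIndep_subset : ∀ ⦃I J : Finset (Fin 9)⦄, thetaIndep J → I ⊆ J → thetaIndep I := by
  native_decide

/-- The augmentation axiom (checked over all pairs of edge sets). -/
theorem thetaIndep_aug : ∀ ⦃I J : Finset (Fin 9)⦄, thetaIndep I → thetaIndep J → I.card < J.card →
    ∃ e ∈ J, e ∉ I ∧ thetaIndep (insert e I) := by
  native_decide

/-- **The matroid `M(Θ(2,2,2,1)) ⊕ U_{1,2}`** on the edge set `Fin 9`. -/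
def theta9 : Matroid (Fin 9) :=
  (IndepMatroid.ofFinset Set.univ thetaIndep thetaIndep_empty thetaIndep_subset thetaIndep_aug
    (fun _ _ => Set.subset_univ _)).matroid

/-- The ground set is every edge. -/
theorem theta9_ground : theta9.E = Set.univ := rfl

/-- The ground set has `9` elements. -/
theorem theta9_ncard : theta9.E.ncard = 9 := by
  rw [theta9_ground, Set.ncard_univ, Nat.card_eq_fintype_card, Fintype.card_fin]

/-- `theta9` is finite (a theorem, not an instance: the cell's typer lint). -/
theorem theta9_finite : theta9.Finite := ⟨Set.toFinite _⟩

/-- Independence in `theta9` of a finite edge set is the predicate `thetaIndep`. -/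
theorem theta9_indep_coe (I : Finset (Fin 9)) : theta9.Indep (I : Set (Fin 9)) ↔ thetaIndep I := by
  unfold theta9
  exact IndepMatroid.ofFinset_indep Set.univ thetaIndep thetaIndep_empty thetaIndep_subset thetaIndep_aug
    (fun _ _ => Set.subset_univ _)

/-- **The decidable absorbing predicate at level `k` for `y = 7`**: `#Z = k`, `Z` and `univ ∖ Z` independent,
`7 ∉ Z`, `insert 7 Z` dependent. -/
abbrev absorbP (k : ℕ) (Z : Finset (Fin 9)) : Prop :=
  Z.card = k ∧ thetaIndep Z ∧ thetaIndep (Finset.univ \ Z) ∧ (7 : Fin 9) ∉ Z ∧ ¬ thetaIndep (insert 7 Z)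

/-- **The transfer**: a finite edge set is a member of `lowAbsorbAt theta9 7 k` iff `absorbP k` holds. -/
theorem mem_lowAbsorbAt_iff (k : ℕ) (Z : Finset (Fin 9)) :
    (Z : Set (Fin 9)) ∈ lowAbsorbAt theta9 7 k ↔ absorbP k Z := by
  have hcoe : theta9.E \ (Z : Set (Fin 9)) = ((Finset.univ \ Z : Finset (Fin 9)) : Set (Fin 9)) := by
    rw [theta9_ground, Finset.coe_sdiff, Finset.coe_univ]
  simp only [lowAbsorbAt, biIndep, Set.mem_setOf_eq, absorbP]
  rw [hcoe, theta9_indep_coe, theta9_indep_coe, ← Finset.coe_insert, theta9_indep_coe, Set.ncard_coe_finset,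
    Finset.mem_coe]
  simp only [theta9_ground, Set.subset_univ, true_and]
  tauto

/-- **The transfer of the absorbing count to a `Finset` computation.** -/
theorem lowAbsorbCount_eq (k : ℕ) :
    lowAbsorbCount theta9 7 k = (Finset.univ.filter (fun T : Finset (Fin 9) => absorbP k T)).card := by
  classical
  unfold lowAbsorbCount
  rw [← Set.ncard_coe_finset]
  symm
  refine Set.ncard_congr (fun T _ => (T : Set (Fin 9))) ?_ ?_ ?_
  · intro T hT
    simp only [Finset.coe_filter, Finset.mem_univ, true_and, Set.mem_setOf_eq] at hT
    exact (mem_lowAbsorbAt_iff k T).mpr hT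
  · intro T T' _ _ h
    exact Finset.coe_inj.mp h
  · intro S hS
    have hfin : S.Finite := Set.toFinite S
    refine ⟨hfin.toFinset, ?_, hfin.coe_toFinset⟩
    simp only [Finset.coe_filter, Finset.mem_univ, true_and, Set.mem_setOf_eq]
    rw [← mem_lowAbsorbAt_iff, hfin.coe_toFinset]
    exact hS

/-- **`A^7_4 = 20`.** -/
theorem lowAbsorbCount_four : lowAbsorbCount theta9 7 4 = 20 := by
  rw [lowAbsorbCount_eq]; native_decide

/-- **`A^7_5 = 20`**: the middle step `(9 − 1 − 4) · A_4 ≤ 4 · A_5` holds with equality. -/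
theorem lowAbsorbCount_five : lowAbsorbCount theta9 7 5 = 20 := by
  rw [lowAbsorbCount_eq]; native_decide

/-- **The twelve members of `A^7_4` through the hub edge `6`** (each = `{a, b, 6, 8}` with `a, b` on different paths). -/
def F0 : Finset (Finset (Fin 9)) :=
  {{0, 2, 6, 8}, {1, 2, 6, 8}, {0, 3, 6, 8}, {1, 3, 6, 8}, {0, 4, 6, 8}, {1, 4, 6, 8},
   {2, 4, 6, 8}, {3, 4, 6, 8}, {0, 5, 6, 8}, {1, 5, 6, 8}, {2, 5, 6, 8}, {3, 5, 6, 8}}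

/-- `F0` has twelve members. -/
theorem F0_card : F0.card = 12 := by decide

/-- Every member of `F0` is absorbing at level `4`. -/
theorem F0_absorb : ∀ Z ∈ F0, absorbP 4 Z := by native_decide

/-- **The up-shadow of `F0` inside `A^7_5`, as a computable `Finset`.** -/
def shadowF : Finset (Finset (Fin 9)) :=
  (Finset.univ.powersetCard 5).filter (fun W => absorbP 5 W ∧ ∃ Z ∈ F0, Z ⊆ W)

/-- The up-shadow of `F0` has eight members. -/
theorem shadowF_card : shadowF.card = 8 := by native_decide

/-- `F0` as a set of sets. -/
def F0set : Set (Set (Fin 9)) := (fun Z : Finset (Fin 9) => (Z : Set (Fin 9))) '' ↑F0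

/-- `F0set ⊆ A^7_4`. -/
theorem F0set_subset : F0set ⊆ lowAbsorbAt theta9 7 4 := by
  rintro S ⟨Z, hZ, rfl⟩
  exact (mem_lowAbsorbAt_iff 4 Z).mpr (F0_absorb Z (Finset.mem_coe.mp hZ))

/-- `#F0set = 12`. -/
theorem F0set_ncard : F0set.ncard = 12 := by
  rw [F0set, Set.ncard_image_of_injective _ Finset.coe_injective, Set.ncard_coe_finset, F0_card]

/-- **The up-shadow of `F0set` in `A^7_5` is the coercion of `shadowF`.** -/
theorem shadow_eq :
    {W ∈ lowAbsorbAt theta9 7 5 | ∃ Z ∈ F0set, Z ⊆ W}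
      = (fun T : Finset (Fin 9) => (T : Set (Fin 9))) '' ↑shadowF := by
  ext W
  constructor
  · rintro ⟨hW, Z, ⟨Z', hZ', rfl⟩, hZW⟩
    have hfin : W.Finite := Set.toFinite W
    refine ⟨hfin.toFinset, ?_, hfin.coe_toFinset⟩
    rw [Finset.mem_coe, shadowF, Finset.mem_filter, Finset.mem_powersetCard]
    have hW' := hW
    rw [← hfin.coe_toFinset, mem_lowAbsorbAt_iff] at hW'
    refine ⟨⟨Finset.subset_univ _, hW'.1⟩, hW', Z', Finset.mem_coe.mp hZ', ?_⟩
    intro x hx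
    rw [Set.Finite.mem_toFinset]
    exact hZW (Finset.mem_coe.mpr hx)
  · rintro ⟨T, hT, rfl⟩
    rw [Finset.mem_coe, shadowF, Finset.mem_filter] at hT
    obtain ⟨-, hP, Z, hZ, hZT⟩ := hT
    refine ⟨(mem_lowAbsorbAt_iff 5 T).mpr hP, (Z : Set (Fin 9)), ⟨Z, Finset.mem_coe.mpr hZ, rfl⟩, ?_⟩
    exact Finset.coe_subset.mpr hZT

/-- **The up-shadow has `8` members.** -/
theorem shadow_ncard : {W ∈ lowAbsorbAt theta9 7 5 | ∃ Z ∈ F0set, Z ⊆ W}.ncard = 8 := by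
  rw [shadow_eq, Set.ncard_image_of_injective _ Finset.coe_injective, Set.ncard_coe_finset, shadowF_card]

/-- **THE KATONA SHADOW FORM OF (ABS-star) IS FALSE**: on `theta9` with `y = 7` at the middle step `k = 4`,
the twelve members through the hub edge have eight up-neighbours, `4 · 12 = 48 > 32 = 4 · 8`. -/
theorem not_absorbShadowHall_theta9 : ¬ AbsorbShadowHall theta9 7 4 := by
  intro h
  have := h F0set F0set_subset
  rw [theta9_ncard, F0set_ncard, shadow_ncard] at this
  exact absurd this (by decide)

end Theta9

end PercRepro
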